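import Summits.QuantumFields.BalabanUV.T4Continuum.Support.TermwiseLocalThm1Coarse
import Summits.QuantumFields.BalabanUV.T4Continuum.Support.TermwiseResidualWitnessLedger

/-!
# TermwiseLocalThm1LedgerW — the term-wise `U(N)` ledger theorem (gen-17 END, coarse form p206379) with leaf S.5
# (R-w)(W-w) PRODUCED: the residual-proper factor's binders `hwpos hRw hRRw∕hrw hWw∕hsw` are no longer hypotheses —
# they come from the FORMAT `w = w′·exp(Σ_{X∈wfac K t τ} vc(K,t,X))` and the eight (W-·) inputs of
# `TermwiseResidualWitness(Ledger)`; conclusion `GoodClause ∧ Summable δ⁗` with `δ⁗`'s residual share DISPLAYED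

Cell `pub-balaban`, rung (B)+1 sub-cell t4, lineage `b2b-balaban-t4-ne7-p1` (node U5 = NE7, TERM-WISE member;
generation 19), skeleton `HOME/t4/b2b-balaban-t4-ne7-p1-g18/SKELETON-NE7-P1.md` §2 leaf S.5 ∕ §3 (w9), record
`t4/T4-EST-NE7-P1.md` §25; companions `Support/TermwiseResidualWitness` (the two brackets),
`Support/TermwiseResidualWitnessLedger` (the binders produced), `Support/TermwiseLocalThm1Coarse` (the END called).
HONEST FRAMING (page 1): FIXED FINITE T⁴, rung (B)+1 = the `ε → 0` limit of unit-scale averaged expectations,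
CONDITIONAL on BetaPertH and the nine spine estimates (0/9 proved); NOT infinite volume, NOT a mass gap, NOT the Clay
problem.  NE7 is NOT PRINTED in [Balaban1984PropagatorsI]–[Balaban1989LargeFieldII] and NOT proved here: every
estimate below is a HYPOTHESIS BINDER named in the statement — the typed Theorem 1 `B11Thm1.Thm1At`, the flow window
(0.31) `h031A`∕`h031B`, the upstream kinds of rows NE2–NE5∕NE9, and now the residual kind's (W-·) inputs; nothing is
hidden in a definition.  [folklore] bookkeeping (ONE CALL of each companion); no definitions, no cite tags; nothing
printed is asserted.

WHAT IS PROVED ([folklore]).  **`goodClause_summable_UN_levels_of_thm1At_residualW`** =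
`TermwiseLocal.goodClause_summable_UN_levels_of_thm1At_coarse` (p206379) with the SIX residual-kind binders
`hwpos hRw hRRw hrw hWw hsw` REPLACED by: (W-fmt) `w· = w·′ · exp(Σ_{X ∈ wfac K t τ} vc·(K,t,X))` with the residue
`w′`'s own five binders (`hw'pos hRw' hRRw' hrw' hWw' hsw'` — trivial when `w′ ≡ 1`, NODE F's format decision),
(W-sc) scales, (W-loc) no `t` off the near-support sub-ledger `nf`, (W-size) one-run slice sizes `vol·Ew·a^{K−j}` of
the t-discrepancies ((2.48)-TYPE shape under H2; located sentences [Balaban1988Convergent] p. 264,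
[Balaban1989LargeFieldII] p. 380), (W-rate-t)∕(W-rate-0) two-run rates `CrW·θ′^{scale}e^{−κd}` (row NE5's named ask at
`U = 1`), (W-mult-F) near-support multiplicity `CF`, (W-win) term ledger vs reference ledger `wfac₀ K` differ only at
levels `≥ jlogOf Cl K` (I-3), (W-mult) multiplicities `Cw`.  CONCLUSION: `GoodClause l₀ vol T A B Bad δ⁗ ∧ Summable δ⁗`
with the END's `δ⁗` in which `rw K` is the residue's `rw′ K` and `sw K` is
`sw′ K + max(CF,1)·(Ew + CrW)·Σ_{j+n=K} min(aⁿ, θ′^jΛⁿ) + 2·CrW·Cw·windowSum θ′ Λ (jlogOf Cl K) K` — every other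
summand VERBATIM.

BINDER CENSUS = the coarse END's census MINUS (R-w)(W-w) PLUS the (W-·) inputs; classes (SKELETON-NE7-P1 §2, v1.7):
(W-fmt) [dict] over NODE O∕F · (W-loc)(W-win) [data] · (W-mult-F)(W-mult) [geom] · (W-size) one-run HYPOTHESIS SHAPE
under H2 · (W-rate-t)(W-rate-0) ROW NE5 · residue binders EMPTY under NODE F's decision.  The road's OWN-OPEN list
after this file: {T.2 analytic margin (shared with row NE9)} modulo t4-ref2's grading of (W-size).  NOT NE7 (spine 0/9
unchanged), NOT summit progress.
-/

noncomputable section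

open Finset MeasureTheory _root_.Filter _root_.Topology
open scoped BigOperators Matrix.Norms.L2Operator

namespace Summit.QuantumFields.BalabanUV.T4Continuum.TermwiseLocal

open Literature.MathematicalPhysics.QuantumFieldTheory.Balaban1983to89
open T4OutputRate T4RecentScale T4GoodClassBudget T4CauchySum T4Crossover T4TowerRateComposition T4TowerRateDischarge
open T4BoundaryCarrier (BFunctional atFl NE9Fl LipBackgroundFl NE5B)
open T4TermwiseBudget T4TermwiseDeviation T4TermwiseCurrency T4TermwiseBoundary T4TermwiseResidual T4TermwiseAction
open T4TermwiseClassical T4TermwiseQuartic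
open T4TermwiseInstantiate (cBCH cBCH_nonneg cSZ cSZ_nonneg)
open T4TermwiseOscillation (cOSC)
open B7Prop1Explicit B7Prop2Explicit B7Prop1Local T4TermwiseBCH T4TermwiseTorus T4TermwiseUN T4TermwiseChainUN B11
open TermwiseBackground (LocReg cReg cOscReg cReg_nonneg)
open TermwiseHolder (HolderReg Realises holderReg_window_family_of_thm1At)

/-! ## The END with leaf S.5 produced -/

section Ledger
variable {n : Type*} [Fintype n] [DecidableEq n] [Nonempty n]
variable {C : T4BoundaryCarrier.Carriers} {ι : Type} [MeasurableSpace ι] {σ : Type*} [DecidableEq σ] {l₀ vol : ℝ}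
  {T : ℕ → Finset σ} {Bad : ℕ → ℝ → Finset σ} {A B : ℕ → ℝ → σ → ℝ} {μ : ℕ → ℝ → σ → Measure ι}
  {fac bfac rfac : ℕ → ℝ → σ → Finset C.Dom} {Adm : Set ι} {EA : Functional C.toCarriers C.BgA}
  {EB : Functional C.toCarriers C.BgB} {BA : BFunctional C C.BgA} {BB : BFunctional C C.BgB}
  {RA : Functional C.toCarriers C.BgA} {RB : Functional C.toCarriers C.BgB}
  {κ θ' Cr EB₀ CrR R₁ b β' w₀ : ℝ} {κ₀ : ℕ} {gA gB : ℕ → ℕ → ℝ} {gfA gfB : ℕ → ℝ} {gsA gsB : ℕ → ℕ → ℝ}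
  {uA : ℕ → ι → C.BgA} {uB : ℕ → ι → C.BgB} {oneA : C.BgA} {oneB : C.BgB}
  {pend : ℕ → ℝ → σ → ι → C.Fl} {nA nB aA aB wA wB γA γB : ℕ → ℝ → σ → ι → ℝ} {qA qB : ℕ → ℝ}
  {κ₁ S : ℕ → ℝ → σ → ℕ → ℝ} {cW' RW' : ℕ → ℝ → σ → ℝ} {rw' sw' rγ zA zB c₀' : ℕ → ℝ} {Cw E a Λ Cl CF Ew CrW : ℝ}

/-- **THE GEN-17 END (coarse form) WITH LEAF S.5 PRODUCED.**  `goodClause_summable_UN_levels_of_thm1At_coarse` with the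
residual kind's binders `hwpos hRw hRRw hrw hWw hsw` no longer hypotheses: they are PRODUCED by
`TermwiseResidualWitness.residualWitness_of_format` ∕ `summable_witnessRadius` from the format (W-fmt) of the
residual-proper factor (field-independent step constants `vc·(K,t,X)` over the ledger `wfac K t τ`, residue `w′` with
its own binders) and the inputs (W-sc)(W-loc)(W-size)(W-rate-t)(W-mult-F)(W-win)(W-rate-0)(W-mult) — all HYPOTHESES,
displayed.  Conclusion `GoodClause l₀ vol T A B Bad δ⁗ ∧ Summable δ⁗`, `δ⁗` as in the END with the residual share
`rw′ K`, `sw′ K + max(CF,1)·(Ew+CrW)·Σ min(aⁿ, θ′^jΛⁿ) + 2·CrW·Cw·windowSum θ′ Λ (jlogOf Cl K) K`.  No print is quoted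
as a fact; `Thm1At` is a hypothesis; NOT NE7, NOT Clay. [folklore] -/
theorem goodClause_summable_UN_levels_of_thm1At_residualW {Y YA : Type*} {Sfib : ℕ → ℝ → σ → ι → Set Y}
    {SfibA : ℕ → ℝ → σ → ι → Set YA} {g : ℕ → ℝ → σ → ι → YA → ℝ} {f₁ : ℕ → ℝ → σ → ι → Y → ℝ}
    {Q : ℕ → ℝ → σ → ι → Y → YA} {yA yB : ℕ → ℝ → σ → ι → Y} {xA : ℕ → ℝ → σ → ι → YA}
    (M L : ℕ) (hMtwo : 2 ≤ M) (hLtwo : 2 ≤ L) (planes : Finset (Fin 4 × Fin 4))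
    (hplanes : ∀ P ∈ planes, P.1 ≠ P.2)
    (famA famB : ℕ → ℝ → σ → ι → VarProblem)
    (ρA : ∀ K t τ v, Realises (famA K t τ v) 4 (Matrix n n ℂ)) (ρB : ∀ K t τ v, Realises (famB K t τ v) 4 (Matrix n n ℂ))
    (UA : ∀ K t τ v, (famA K t τ v).Cfg) (UB : ∀ K t τ v, (famB K t τ v).Cfg)
    (lvlA lvlB : ℕ → ℝ → σ → ι → (Fin 4 × Fin 4) × B7Prop1Explicit.Site 4 → ℕ)
    (Cst : B11Thm1.Consts) {Mc ε₁ β₀ : ℝ}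
    (hUR : ∀ K, URateUpTo K EA EB (gA K) (gB K) (uA K) (uB K) Adm Cr θ' κ) (hCr : 0 ≤ Cr)
    (hθ'0 : 0 < θ') (hθ'1 : θ' < 1) (hθ'Λ : θ' ≤ Λ) (hΛ1 : 1 ≤ Λ) (hCl : 0 ≤ Cl)
    (hURB : ∀ b ∈ C.admFl, ∀ K, URateUpTo K (atFl BA b) (atFl BB b) (gA K) (gB K) (uA K) (uB K) Adm EB₀ θ' κ)
    (hEB₀ : 0 ≤ EB₀)
    (hURR : ∀ K, URateUpTo K RA RB (gA K) (gB K) (uA K) (uB K) Adm CrR θ' κ) (hCrR : 0 ≤ CrR)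
    (hfmtA : ∀ K t τ, A K t τ = ∫ v, (∏ X ∈ fac K t τ,
      Real.exp (EA (gA K) (uA K v) X - EA (gA K) oneA X)) *
        ((∏ X ∈ bfac K t τ, Real.exp (BA (gA K) (uA K v) (pend K t τ v) X)) * nA K t τ v * qA K *
          ((∏ X ∈ rfac K t τ, Real.exp (RA (gA K) (uA K v) X - RA (gA K) oneA X)) * (Real.exp (-aA K t τ v) * wA K t τ v)))
          ∂(μ K t τ))
    (hfmtB : ∀ K t τ, B K t τ = ∫ v, (∏ X ∈ fac K t τ,
      Real.exp (EB (gB K) (uB K v) X - EB (gB K) oneB X)) *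
        ((∏ X ∈ bfac K t τ, Real.exp (BB (gB K) (uB K v) (pend K t τ v) X)) * nB K t τ v * qB K *
          ((∏ X ∈ rfac K t τ, Real.exp (RB (gB K) (uB K v) X - RB (gB K) oneB X)) * (Real.exp (-aB K t τ v) * wB K t τ v)))
          ∂(μ K t τ))
    (hint : ∀ K t, |t| ≤ l₀ → ∀ τ ∈ T K \ Bad K t,
      Integrable (fun v => (∏ X ∈ fac K t τ, Real.exp (EA (gA K) (uA K v) X - EA (gA K) oneA X)) *
        ((∏ X ∈ bfac K t τ, Real.exp (BA (gA K) (uA K v) (pend K t τ v) X)) * nA K t τ v * qA K *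
          ((∏ X ∈ rfac K t τ, Real.exp (RA (gA K) (uA K v) X - RA (gA K) oneA X)) * (Real.exp (-aA K t τ v) * wA K t τ v))))
          (μ K t τ) ∧
      Integrable (fun v => (∏ X ∈ fac K t τ, Real.exp (EB (gB K) (uB K v) X - EB (gB K) oneB X)) *
        ((∏ X ∈ bfac K t τ, Real.exp (BB (gB K) (uB K v) (pend K t τ v) X)) * nB K t τ v * qB K *
          ((∏ X ∈ rfac K t τ, Real.exp (RB (gB K) (uB K v) X - RB (gB K) oneB X)) * (Real.exp (-aB K t τ v) * wB K t τ v))))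
          (μ K t τ))
    (hsc : ∀ K t, |t| ≤ l₀ → ∀ τ ∈ T K \ Bad K t, ∀ X ∈ fac K t τ, C.scale X ≤ K)
    (hoff : ∀ K t, |t| ≤ l₀ → ∀ τ ∈ T K \ Bad K t, ∀ v, v ∉ Adm →
      (∏ X ∈ fac K t τ, Real.exp (EA (gA K) (uA K v) X - EA (gA K) oneA X)) *
        ((∏ X ∈ bfac K t τ, Real.exp (BA (gA K) (uA K v) (pend K t τ v) X)) * nA K t τ v * qA K *
          ((∏ X ∈ rfac K t τ, Real.exp (RA (gA K) (uA K v) X - RA (gA K) oneA X)) * (Real.exp (-aA K t τ v) * wA K t τ v)))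
          = 0 ∧
      (∏ X ∈ fac K t τ, Real.exp (EB (gB K) (uB K v) X - EB (gB K) oneB X)) *
        ((∏ X ∈ bfac K t τ, Real.exp (BB (gB K) (uB K v) (pend K t τ v) X)) * nB K t τ v * qB K *
          ((∏ X ∈ rfac K t τ, Real.exp (RB (gB K) (uB K v) X - RB (gB K) oneB X)) * (Real.exp (-aB K t τ v) * wB K t τ v)))
          = 0)
    (hS : ∀ K t, |t| ≤ l₀ → ∀ τ ∈ T K \ Bad K t, ∀ v ∈ Adm, ∀ j ≤ K,
      |(∑ X ∈ fac K t τ with C.scale X = j,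
          (Real.log (Real.exp (EB (gB K) (uB K v) X - EB (gB K) oneB X))
            - Real.log (Real.exp (EA (gA K) (uA K v) X - EA (gA K) oneA X)))) - κ₁ K t τ j| ≤ S K t τ j)
    (hM : ∀ K t, |t| ≤ l₀ → ∀ τ ∈ T K \ Bad K t,
      Multiplicity (fac K t τ) C.scale (fun X => Real.exp (-(κ * C.d X))) Cw vol Λ K)
    (hwit : ∀ K, ∃ v₁ ∈ Adm, uA K v₁ = oneA ∧ uB K v₁ = oneB)
    (hvol : 0 ≤ vol) (hE : 0 ≤ E) (ha0 : 0 < a) (ha1 : a < 1)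
    (hSle : ∀ K t, |t| ≤ l₀ → ∀ τ ∈ T K \ Bad K t, ∀ j ≤ K, S K t τ j ≤ vol * (E * a ^ (K - j)))
    (hpend : ∀ K t, |t| ≤ l₀ → ∀ τ ∈ T K \ Bad K t, ∀ v ∈ Adm, pend K t τ v ∈ C.admFl)
    (hBwin : ∀ K t, |t| ≤ l₀ → ∀ τ ∈ T K \ Bad K t, RecentOnly (bfac K t τ) C.scale (jlogOf Cl K) K)
    (hMB : ∀ K t, |t| ≤ l₀ → ∀ τ ∈ T K \ Bad K t,
      Multiplicity (bfac K t τ) C.scale (fun X => Real.exp (-(κ * C.d X))) Cw vol Λ K)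
    (hnpos : ∀ K t, |t| ≤ l₀ → ∀ τ ∈ T K \ Bad K t, ∀ v ∈ Adm, 0 < nA K t τ v ∧ 0 < nB K t τ v)
    (hzA : ∀ K t, |t| ≤ l₀ → ∀ τ ∈ T K \ Bad K t, ∀ v ∈ Adm, |Real.log (nA K t τ v)| ≤ vol * zA K)
    (hzB : ∀ K t, |t| ≤ l₀ → ∀ τ ∈ T K \ Bad K t, ∀ v ∈ Adm, |Real.log (nB K t τ v)| ≤ vol * zB K)
    (hzAs : Summable zA) (hzBs : Summable zB)
    (hq : ∀ K, 0 < qA K ∧ 0 < qB K)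
    -- the 𝐑-kind: scales, multiplicity, one-run slice sizes, the flow window of both coupling tables
    (hrsc : ∀ K t, |t| ≤ l₀ → ∀ τ ∈ T K \ Bad K t, ∀ X ∈ rfac K t τ, C.scale X ≤ K)
    (hMR : ∀ K t, |t| ≤ l₀ → ∀ τ ∈ T K \ Bad K t,
      Multiplicity (rfac K t τ) C.scale (fun X => Real.exp (-(κ * C.d X))) Cw vol Λ K)
    (hRSA : ∀ K t, |t| ≤ l₀ → ∀ τ ∈ T K \ Bad K t, ∀ v ∈ Adm, ∀ j ≤ K,
      |∑ X ∈ rfac K t τ with C.scale X = j, (RA (gA K) (uA K v) X - RA (gA K) oneA X)| ≤ vol * (R₁ * gsA K j ^ κ₀))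
    (hRSB : ∀ K t, |t| ≤ l₀ → ∀ τ ∈ T K \ Bad K t, ∀ v ∈ Adm, ∀ j ≤ K,
      |∑ X ∈ rfac K t τ with C.scale X = j, (RB (gB K) (uB K v) X - RB (gB K) oneB X)| ≤ vol * (R₁ * gsB K j ^ κ₀))
    (hb : 0 < b) (h031A : ∀ K, Step.Discrete031 b β' K (gfA K) (gsA K))
    (h031B : ∀ K, Step.Discrete031 b β' K (gfB K) (gsB K)) (hgsA : ∀ K k, k ≤ K → 0 ≤ gsA K k)
    (hgsB : ∀ K k, k ≤ K → 0 ≤ gsB K k) (hR₁ : 0 ≤ R₁) (hκ₀ : 4 < κ₀)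
    -- the ACTION kind from ONE CLASSICAL STEP: (min-A) (Q) (lift) (min-B) (act) (U) (L) (γ)
    (hminA : ∀ K t, |t| ≤ l₀ → ∀ τ ∈ T K \ Bad K t, ∀ v ∈ Adm, IsMinOn (g K t τ v) (SfibA K t τ v) (xA K t τ v))
    (hQ : ∀ K t, |t| ≤ l₀ → ∀ τ ∈ T K \ Bad K t, ∀ v ∈ Adm, Set.MapsTo (Q K t τ v) (Sfib K t τ v) (SfibA K t τ v))
    (hlift : ∀ K t, |t| ≤ l₀ → ∀ τ ∈ T K \ Bad K t, ∀ v ∈ Adm,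
      yA K t τ v ∈ Sfib K t τ v ∧ Q K t τ v (yA K t τ v) = xA K t τ v)
    (hminB : ∀ K t, |t| ≤ l₀ → ∀ τ ∈ T K \ Bad K t, ∀ v ∈ Adm,
      yB K t τ v ∈ Sfib K t τ v ∧ IsMinOn (f₁ K t τ v) (Sfib K t τ v) (yB K t τ v))
    (hact : ∀ K t, |t| ≤ l₀ → ∀ τ ∈ T K \ Bad K t, ∀ v ∈ Adm,
      aA K t τ v = w₀ * g K t τ v (xA K t τ v) + γA K t τ v ∧
        aB K t τ v = w₀ * f₁ K t τ v (yB K t τ v) + γB K t τ v)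
    (hw₀ : 0 ≤ w₀)
    -- (U)(L) PRODUCED for G = U(N) Wilson terms from the PRINTED-CURRENCY regularity binder PER WINDOW AT THE WINDOW's
    -- LEVEL (`HolderReg` = B11 Thm 1 (9) read with B9 (3.40) at U₀ = 1, spacing (L^{lvl y})⁻¹, Hölder exponent β₀):
    -- unitarity + periodicity `hAU hBU`, `hA9W hB9W` on the window boxes, `hB9F` at run B's fine plaquettes, the
    -- window clauses `hwinA hwinB hwinBf`, the constants' signs, `ε₁ ≤ 1`, the smallness, `0 < β₀ ≤ 1`
    (hAU : ∀ K t, |t| ≤ l₀ → ∀ τ ∈ T K \ Bad K t, ∀ v ∈ Adm,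
      (∀ x κ, (ρA K t τ v).cfg (UA K t τ v) x κ ∈ unitaryUnits (Matrix n n ℂ)) ∧
        IsPeriodic (M * L ^ K * L) ((ρA K t τ v).cfg (UA K t τ v)))
    (hBU : ∀ K t, |t| ≤ l₀ → ∀ τ ∈ T K \ Bad K t, ∀ v ∈ Adm,
      (∀ x κ, (ρB K t τ v).cfg (UB K t τ v) x κ ∈ unitaryUnits (Matrix n n ℂ)) ∧
        IsPeriodic (M * L ^ K * L) ((ρB K t τ v).cfg (UB K t τ v)))
    -- THE TYPED THEOREM 1 PER RUN (one block of constants `Cst`), its data, and the PER-LEVEL coverings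
    (hPLA : ∀ K t τ v, (famA K t τ v).L = (L : ℝ)) (hetaA : ∀ K t τ v, (famA K t τ v).eta = ((L : ℝ) ^ K)⁻¹)
    (hPLB : ∀ K t τ v, (famB K t τ v).L = (L : ℝ)) (hetaB : ∀ K t τ v, (famB K t τ v).eta = ((L : ℝ) ^ K)⁻¹)
    (hTA : ∀ K t τ v, B11Thm1.Thm1At Cst (famA K t τ v)) (hTB : ∀ K t τ v, B11Thm1.Thm1At Cst (famB K t τ v))
    (hε₁a : ε₁ ≤ Cst.a₁) (VbA : ∀ K t τ v, (famA K t τ v).Bdry) (VbB : ∀ K t τ v, (famB K t τ v).Bdry)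
    (hVbA : ∀ K t τ v, (famA K t τ v).Reg7 ε₁ (VbA K t τ v)) (hVbB : ∀ K t τ v, (famB K t τ v).Reg7 ε₁ (VbB K t τ v))
    (hUA : ∀ K t τ v, (famA K t τ v).OnMinimalOrbit (Cst.B₃ * ε₁) (VbA K t τ v) (UA K t τ v))
    (hUB : ∀ K t τ v, (famB K t τ v).OnMinimalOrbit (Cst.B₃ * ε₁) (VbB K t τ v) (UB K t τ v))
    (hMc0 : 0 ≤ Mc) (hMc : Mc ≤ Cst.Mfun ε₁)
    (hlvlA : ∀ K t τ v, ∀ y ∈ pbox planes (M * L ^ K), lvlA K t τ v y ≤ K)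
    (hlvlB : ∀ K t τ v, ∀ y ∈ pbox planes (M * L ^ K), lvlB K t τ v y ≤ K)
    (hcoverA : ∀ K t, |t| ≤ l₀ → ∀ τ ∈ T K \ Bad K t, ∀ v ∈ Adm, ∀ y ∈ pbox planes (M * L ^ K),
      ∀ x : B7Prop1Explicit.Site 4, InBox ((L : ℤ) • y.2) (deltaHi L ((L : ℤ) • y.2) y.1.1 y.1.2) x →
        ∃ c : (famA K t τ v).Cube, (famA K t τ v).scale c = lvlA K t τ v y ∧ (famA K t τ v).sizeM c ≤ Mc ∧
          l1 (x - (ρA K t τ v).centre c) + 6 ≤ (ρA K t τ v).radius c)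
    (hcoverB : ∀ K t, |t| ≤ l₀ → ∀ τ ∈ T K \ Bad K t, ∀ v ∈ Adm, ∀ y ∈ pbox planes (M * L ^ K),
      ∀ x : B7Prop1Explicit.Site 4, InBox ((L : ℤ) • y.2) (deltaHi L ((L : ℤ) • y.2) y.1.1 y.1.2) x →
        ∃ c : (famB K t τ v).Cube, (famB K t τ v).scale c = lvlB K t τ v y ∧ (famB K t τ v).sizeM c ≤ Mc ∧
          l1 (x - (ρB K t τ v).centre c) + 6 ≤ (ρB K t τ v).radius c)
    (hwinA : ∀ K t, |t| ≤ l₀ → ∀ τ ∈ T K \ Bad K t, ∀ v ∈ Adm,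
      RecentOnly (pbox planes (M * L ^ K)) (lvlA K t τ v) (jlogOf Cl K) K)
    (hwinB : ∀ K t, |t| ≤ l₀ → ∀ τ ∈ T K \ Bad K t, ∀ v ∈ Adm,
      RecentOnly (pbox planes (M * L ^ K)) (lvlB K t τ v) (jlogOf Cl K) K)
    (hε₁ : 0 < ε₁) (hε₁1 : ε₁ ≤ 1)
    (hsmall : 20480 * (L : ℝ) ^ 2 * (cReg (Cst.B₃ * Mc) (Cst.B₃ * Mc) * ε₁) ≤ 1) (hβ₀ : 0 < β₀) (hβ₀1 : β₀ ≤ 1)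
    (hreprU : ∀ K t, |t| ≤ l₀ → ∀ τ ∈ T K \ Bad K t, ∀ v ∈ Adm,
      f₁ K t τ v (yA K t τ v) = ∑ x ∈ pbox planes (M * L ^ K * L), eN (phiU ((ρA K t τ v).cfg (UA K t τ v)) x) ∧
        g K t τ v (xA K t τ v) = ∑ y ∈ pbox planes (M * L ^ K), eN (psiU L ((ρA K t τ v).cfg (UA K t τ v)) y))
    (hreprL : ∀ K t, |t| ≤ l₀ → ∀ τ ∈ T K \ Bad K t, ∀ v ∈ Adm,
      f₁ K t τ v (yB K t τ v) = ∑ x ∈ pbox planes (M * L ^ K * L), eN (phiU ((ρB K t τ v).cfg (UB K t τ v)) x) ∧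
        g K t τ v (Q K t τ v (yB K t τ v)) = ∑ y ∈ pbox planes (M * L ^ K), eN (psiU L ((ρB K t τ v).cfg (UB K t τ v)) y))
    (hMvol : ((M : ℝ)) ^ 4 ≤ vol)
    (hγ : ∀ K t, |t| ≤ l₀ → ∀ τ ∈ T K \ Bad K t, ∀ v ∈ Adm, |γB K t τ v - γA K t τ v| ≤ vol * rγ K)
    (hrγ : Summable rγ)
    -- leaf S.5 PRODUCED (`TermwiseResidualWitness(Ledger)`): (W-fmt) the residual-proper factor's FORMAT with a residue
    -- `w′` keeping the END's own binder shapes; (W-sc)(W-loc)(W-size)(W-rate-t)(W-mult-F)(W-win)(W-rate-0)(W-mult)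
    (wA' wB' : ℕ → ℝ → σ → ι → ℝ) (wfac nf : ℕ → ℝ → σ → Finset C.Dom) (wfac₀ : ℕ → Finset C.Dom)
    (vcA vcB : ℕ → ℝ → C.Dom → ℝ) (hEw : 0 ≤ Ew) (hCrW : 0 ≤ CrW)
    (hwA : ∀ K t, |t| ≤ l₀ → ∀ τ ∈ T K \ Bad K t, ∀ v ∈ Adm,
      wA K t τ v = wA' K t τ v * Real.exp (∑ X ∈ wfac K t τ, vcA K t X))
    (hwB : ∀ K t, |t| ≤ l₀ → ∀ τ ∈ T K \ Bad K t, ∀ v ∈ Adm,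
      wB K t τ v = wB' K t τ v * Real.exp (∑ X ∈ wfac K t τ, vcB K t X))
    (hw'pos : ∀ K t, |t| ≤ l₀ → ∀ τ ∈ T K \ Bad K t, ∀ v ∈ Adm, 0 < wA' K t τ v ∧ 0 < wB' K t τ v)
    (hRw' : ∀ K t, |t| ≤ l₀ → ∀ τ ∈ T K \ Bad K t, ∀ v ∈ Adm,
      |Real.log (wB' K t τ v) - Real.log (wA' K t τ v) - cW' K t τ| ≤ RW' K t τ)
    (hRRw' : ∀ K t, |t| ≤ l₀ → ∀ τ ∈ T K \ Bad K t, RW' K t τ ≤ vol * rw' K) (hrw' : Summable rw')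
    (hWw' : ∀ K t, |t| ≤ l₀ → ∀ τ ∈ T K \ Bad K t, ∀ v ∈ Adm, uA K v = oneA → uB K v = oneB →
      |Real.log (wB' K t τ v) - Real.log (wA' K t τ v) - c₀' K| ≤ vol * sw' K)
    (hsw' : Summable sw')
    (hWsc : ∀ K t, |t| ≤ l₀ → ∀ τ ∈ T K \ Bad K t, ∀ X ∈ wfac K t τ, C.scale X ≤ K)
    (hWsc₀ : ∀ K, ∀ X ∈ wfac₀ K, C.scale X ≤ K)
    (hWloc : ∀ K t, |t| ≤ l₀ → ∀ τ ∈ T K \ Bad K t, ∀ X ∈ wfac K t τ, X ∉ nf K t τ →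
      vcA K t X = vcA K 0 X ∧ vcB K t X = vcB K 0 X)
    (hWsize : ∀ K t, |t| ≤ l₀ → ∀ τ ∈ T K \ Bad K t, ∀ j ≤ K,
      ∑ X ∈ wfac K t τ with C.scale X = j, (|vcA K t X - vcA K 0 X| + |vcB K t X - vcB K 0 X|)
        ≤ vol * (Ew * a ^ (K - j)))
    (hWratet : ∀ K t, |t| ≤ l₀ → ∀ τ ∈ T K \ Bad K t, ∀ X ∈ wfac K t τ, X ∈ nf K t τ →
      |(vcB K t X - vcB K 0 X) - (vcA K t X - vcA K 0 X)| ≤ CrW * θ' ^ C.scale X * Real.exp (-(κ * C.d X)))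
    (hWMF : ∀ K t, |t| ≤ l₀ → ∀ τ ∈ T K \ Bad K t,
      Multiplicity (nf K t τ) C.scale (fun X => Real.exp (-(κ * C.d X))) CF vol Λ K)
    (hWwin : ∀ K t, |t| ≤ l₀ → ∀ τ ∈ T K \ Bad K t, ∀ X ∈ wfac K t τ, X ∉ wfac₀ K → jlogOf Cl K ≤ C.scale X)
    (hWwin₀ : ∀ K t, |t| ≤ l₀ → ∀ τ ∈ T K \ Bad K t, ∀ X ∈ wfac₀ K, X ∉ wfac K t τ → jlogOf Cl K ≤ C.scale X)
    (hWrate0 : ∀ K t, |t| ≤ l₀ → ∀ τ ∈ T K \ Bad K t, ∀ X ∈ wfac K t τ,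
      |vcB K 0 X - vcA K 0 X| ≤ CrW * θ' ^ C.scale X * Real.exp (-(κ * C.d X)))
    (hWrate0' : ∀ K, ∀ X ∈ wfac₀ K, |vcB K 0 X - vcA K 0 X| ≤ CrW * θ' ^ C.scale X * Real.exp (-(κ * C.d X)))
    (hWM : ∀ K t, |t| ≤ l₀ → ∀ τ ∈ T K \ Bad K t,
      Multiplicity (wfac K t τ) C.scale (fun X => Real.exp (-(κ * C.d X))) Cw vol Λ K)
    (hWM₀ : ∀ K, Multiplicity (wfac₀ K) C.scale (fun X => Real.exp (-(κ * C.d X))) Cw vol Λ K) :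
    GoodClause l₀ vol T A B Bad
        (fun K => (max Cw 1 * ((E + Cr) * ∑ x ∈ antidiagonal K, min (a ^ x.2) (θ' ^ x.1 * Λ ^ x.2))
            + (EB₀ * Cw * windowSum θ' Λ (jlogOf Cl K) K + (zA K + zB K)
              + (max (2 * Cw) 1 * ((∑ p ∈ antidiagonal K, min (R₁ * gsA K p.1 ^ κ₀) (CrR * θ' ^ p.1 * Λ ^ p.2))
                  + ∑ p ∈ antidiagonal K, min (R₁ * gsB K p.1 ^ κ₀) (CrR * θ' ^ p.1 * Λ ^ p.2))
                + (w₀ * ((planes.card : ℝ) * (cOSC L (cOscReg L (Cst.B₃ * Mc) (Cst.B₃ * Mc) (Cst.B₄ * Mc)) ^ 2 * ε₁ ^ 2 / 4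
                        * windowSum (((L : ℝ) ^ (-β₀)) ^ 2) ((L : ℝ) ^ 4) (jlogOf Cl K) K
                      + (cSZ L (cReg (Cst.B₃ * Mc) (Cst.B₃ * Mc)) * cBCH L (cReg (Cst.B₃ * Mc) (Cst.B₃ * Mc)) * ε₁ ^ 3
                          + (Fintype.card n : ℝ) / 24 * (cSZ L (cReg (Cst.B₃ * Mc) (Cst.B₃ * Mc)) * ε₁
                            + cBCH L (cReg (Cst.B₃ * Mc) (Cst.B₃ * Mc)) * ε₁ ^ 2) ^ 4)
                        * windowSum (((L : ℝ) ^ 2)⁻¹) ((L : ℝ) ^ 4) (jlogOf Cl K) K)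
                    + (planes.card : ℝ)
                      * (cSZ L (cReg (Cst.B₃ * Mc) (Cst.B₃ * Mc)) * cBCH L (cReg (Cst.B₃ * Mc) (Cst.B₃ * Mc)) * ε₁ ^ 3
                        + cBCH L (cReg (Cst.B₃ * Mc) (Cst.B₃ * Mc)) ^ 2 * ε₁ ^ 4 / 2
                        + (Fintype.card n : ℝ) / 24 * (cSZ L (cReg (Cst.B₃ * Mc) (Cst.B₃ * Mc)) ^ 4 * ε₁ ^ 4))
                      * windowSum (((L : ℝ) ^ 2)⁻¹) ((L : ℝ) ^ 4) (jlogOf Cl K) K)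
                  + rγ K + rw' K))))
          + (max Cw 1 * ((E + Cr) * ∑ x ∈ antidiagonal K, min (a ^ x.2) (θ' ^ x.1 * Λ ^ x.2)) 
            + (rw' K + (sw' K + (max CF 1 * ((Ew + CrW) * ∑ x ∈ antidiagonal K, min (a ^ x.2) (θ' ^ x.1 * Λ ^ x.2))
              + 2 * (CrW * Cw * windowSum θ' Λ (jlogOf Cl K) K)))))) ∧
      Summable (fun K => (max Cw 1 * ((E + Cr) * ∑ x ∈ antidiagonal K, min (a ^ x.2) (θ' ^ x.1 * Λ ^ x.2))
            + (EB₀ * Cw * windowSum θ' Λ (jlogOf Cl K) K + (zA K + zB K)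
              + (max (2 * Cw) 1 * ((∑ p ∈ antidiagonal K, min (R₁ * gsA K p.1 ^ κ₀) (CrR * θ' ^ p.1 * Λ ^ p.2))
                  + ∑ p ∈ antidiagonal K, min (R₁ * gsB K p.1 ^ κ₀) (CrR * θ' ^ p.1 * Λ ^ p.2))
                + (w₀ * ((planes.card : ℝ) * (cOSC L (cOscReg L (Cst.B₃ * Mc) (Cst.B₃ * Mc) (Cst.B₄ * Mc)) ^ 2 * ε₁ ^ 2 / 4
                        * windowSum (((L : ℝ) ^ (-β₀)) ^ 2) ((L : ℝ) ^ 4) (jlogOf Cl K) K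
                      + (cSZ L (cReg (Cst.B₃ * Mc) (Cst.B₃ * Mc)) * cBCH L (cReg (Cst.B₃ * Mc) (Cst.B₃ * Mc)) * ε₁ ^ 3
                          + (Fintype.card n : ℝ) / 24 * (cSZ L (cReg (Cst.B₃ * Mc) (Cst.B₃ * Mc)) * ε₁
                            + cBCH L (cReg (Cst.B₃ * Mc) (Cst.B₃ * Mc)) * ε₁ ^ 2) ^ 4)
                        * windowSum (((L : ℝ) ^ 2)⁻¹) ((L : ℝ) ^ 4) (jlogOf Cl K) K)
                    + (planes.card : ℝ)
                      * (cSZ L (cReg (Cst.B₃ * Mc) (Cst.B₃ * Mc)) * cBCH L (cReg (Cst.B₃ * Mc) (Cst.B₃ * Mc)) * ε₁ ^ 3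
                        + cBCH L (cReg (Cst.B₃ * Mc) (Cst.B₃ * Mc)) ^ 2 * ε₁ ^ 4 / 2
                        + (Fintype.card n : ℝ) / 24 * (cSZ L (cReg (Cst.B₃ * Mc) (Cst.B₃ * Mc)) ^ 4 * ε₁ ^ 4))
                      * windowSum (((L : ℝ) ^ 2)⁻¹) ((L : ℝ) ^ 4) (jlogOf Cl K) K)
                  + rγ K + rw' K))))
          + (max Cw 1 * ((E + Cr) * ∑ x ∈ antidiagonal K, min (a ^ x.2) (θ' ^ x.1 * Λ ^ x.2)) 
            + (rw' K + (sw' K + (max CF 1 * ((Ew + CrW) * ∑ x ∈ antidiagonal K, min (a ^ x.2) (θ' ^ x.1 * Λ ^ x.2))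
              + 2 * (CrW * Cw * windowSum θ' Λ (jlogOf Cl K) K)))))) := by
  obtain ⟨hwpos, hRw, hRRw, hWw⟩ := TermwiseResidualWitness.residualWitness_of_format (l₀ := l₀) (vol := vol)
    (T := T) (Bad := Bad) (Adm := Adm) uA uB oneA oneB wA wB wA' wB' wfac nf wfac₀ vcA vcB C.scale
    (fun X => Real.exp (-(κ * C.d X))) (cW' := cW') (RW' := RW') (rw' := rw') (sw' := sw') (c₀' := c₀') (CF := CF)
    (Cw := Cw) (Ew := Ew) (a := a) (θ' := θ') (Λ := Λ) (CrW := CrW) (Cl := Cl) hvol hEw ha0.le hθ'0.le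
    (zero_le_one.trans hΛ1) hCrW hwA hwB hw'pos hRw' hRRw' hWw' hWsc hWsc₀ hWloc hWsize hWratet
    (fun X => (Real.exp_pos _).le) hWMF hWwin hWwin₀ hWrate0 hWrate0' hWM hWM₀
  have hsw := TermwiseResidualWitness.summable_witnessRadius (CF := CF) (Cw := Cw) (Ew := Ew) (CrW := CrW) (Cl := Cl)
    hsw' ha0 ha1 hθ'0 hθ'1 hθ'Λ hΛ1 hCl
  exact goodClause_summable_UN_levels_of_thm1At_coarse M L hMtwo hLtwo planes hplanes famA famB ρA ρB UA UB lvlA lvlB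
    Cst hUR hCr hθ'0 hθ'1 hθ'Λ hΛ1 hCl hURB hEB₀ hURR hCrR hfmtA hfmtB hint hsc hoff hS hM hwit hvol hE ha0 ha1 hSle hpend
    hBwin hMB hnpos hzA hzB hzAs hzBs hq hrsc hMR hRSA hRSB hb h031A h031B hgsA hgsB hR₁ hκ₀ hminA hQ hlift hminB hact hw₀
    hAU hBU hPLA hetaA hPLB hetaB hTA hTB hε₁a VbA VbB hVbA hVbB hUA hUB hMc0 hMc hlvlA hlvlB hcoverA hcoverB hwinA hwinB
    hε₁ hε₁1 hsmall hβ₀ hβ₀1 hreprU hreprL hMvol hγ hrγ hwpos hRw hRRw hrw' hWw hsw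

end Ledger

end Summit.QuantumFields.BalabanUV.T4Continuum.TermwiseLocal
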